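import Mathlib
import Summits.ValiantsHypothesis.ValiantsHypothesis.Theorems.SymmetroidPencilBasics

/-!
# ValiantsHypothesis / LacunarySymmetroid — crux `MatrixDescartes` (stmt-ValiantsHypothesis-18050),
# line `Cruxes/MatrixDescartes/Lines/sign_split.lean`, stub `stub_split` (`SplitToSemidefinite`)

The line's stub `stub_split : SplitToSemidefinite` (size M, EXPONENT SPLITTING) is PROVED here.  Its
statement is the line's Prop `SplitToSemidefinite` with the line's local vocabulary (`pencil`,
`Alternates`, `posRootCount`, `signed`) UNFOLDED to Mathlib terms (the line file lives under `Cruxes/`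
and carries the other stubs' `sorry`s, so it cannot be imported here); the two statements agree
definitionally, so the line closes its stub by `exact stub_split`.

**Statement.** If the determinant of a lacunary pencil `F(X) = Σ_l X^{d_l} S_l` of real symmetric
`m × m` matrices (`K` terms) alternates strictly in sign along positive points `τ_0 < ⋯ < τ_N`, then
some pencil of the SAME size `m` with at most `2K` terms, STRICTLY INCREASING exponents and coefficients
`± A_l` with every `A_l` POSITIVE SEMIDEFINITE has at least `N` distinct positive roots.

**Proof (no spectral theorem needed).**  Split `S_l = A_l⁺ − A_l⁻` with `A_l⁺ = S_l + λ_l·1`,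
`A_l⁻ = λ_l·1`, `λ_l = Σ_{a,b} |(S_l)_{ab}|` (both PSD: `|xᵀ S x| ≤ λ_l ‖x‖²`).  For an integer `M` put
`G(u) = Σ_l ( u^{M d_l + 2l} A_l⁺ − u^{M d_l + 2l + 1} A_l⁻ )`: `2K` terms with pairwise DISTINCT exponents
once `M ≥ 2K` (sorted increasingly by `Tuple.sort`).  At `u = τ^{1/M}` one has
`G(τ^{1/M}) = Σ_l τ^{d_l} (s^{2l} A_l⁺ − s^{2l+1} A_l⁻)` with `s = τ^{1/M} → 1` as `M → ∞`, whose
determinant tends to `det Σ_l τ^{d_l} S_l = det F(τ)`; the finitely many strict sign conditions therefore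
hold for `det G` at the points `τ_j^{1/M}` for all large `M`, and the tree lemma
`le_card_posRoots_of_alternating` (IVT) yields `N` distinct positive roots of `det G`.

Honest framing: an M-sized stub of a registered line of the V1 crux; the line's `stub_perturb` (L) and
`stub_bmd` (the bilinear semidefinite matrix Descartes rule, open at `V = 2`) are untouched; the crux
`LacunarySymmetroid.MatrixDescartes` and rung V1 do NOT move; `VP ≠ VNP` is NOT proved and nothing here
is progress on it.  No new definitions, no named facts.
-/

-- `Summit.ValiantsHypothesis.ValiantsHypothesis.…` is the tree's mandated single-conjunct layout
-- (Sub = Summit), so the duplicated namespace component is intended.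
set_option linter.dupNamespace false

namespace Summit.ValiantsHypothesis.ValiantsHypothesis.Theorems.LacunarySymmetroidMatrixDescartes

open Polynomial Matrix Finset Filter Topology
open scoped BigOperators

open Summit.ValiantsHypothesis.ValiantsHypothesis.Theorems.SymmetroidDescartes
  (eval_det_pencil le_card_posRoots_of_alternating)

namespace Split

/-! ### The semidefinite split `S = (S + λ·1) − λ·1` -/

/-- A constant nonnegative diagonal matrix is positive semidefinite. [folklore] -/
theorem posSemidef_diagonal_const {m : ℕ} {c : ℝ} (hc : 0 ≤ c) :
    (Matrix.diagonal (fun _ : Fin m => c)).PosSemidef :=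
  Matrix.PosSemidef.diagonal (fun _ => hc)

/-- For a real symmetric `S`, the matrix `S + λ·1` with `λ = Σ_{a,b} |S_{ab}|` is positive semidefinite
(`|xᵀ S x| ≤ λ ‖x‖²`). [folklore] -/
theorem posSemidef_add_diagonal {m : ℕ} (S : Matrix (Fin m) (Fin m) ℝ) (hS : S.IsSymm) :
    (S + Matrix.diagonal (fun _ : Fin m => ∑ a, ∑ b, |S a b|)).PosSemidef := by
  refine Matrix.PosSemidef.of_dotProduct_mulVec_nonneg ?_ fun x => ?_
  · have h1 : S.IsHermitian := by
      change Sᴴ = S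
      rw [Matrix.conjTranspose_eq_transpose_of_trivial]
      exact hS
    exact h1.add (posSemidef_diagonal_const
      (Finset.sum_nonneg fun a _ => Finset.sum_nonneg fun b _ => abs_nonneg (S a b))).1
  · -- `xᵀ (S + λ·1) x = Σ_{a,b} S_ab x_a x_b + λ Σ_c x_c²`
    set Q : ℝ := ∑ c, x c * x c with hQ
    have hQnn : 0 ≤ Q := Finset.sum_nonneg fun c _ => mul_self_nonneg (x c)
    have hsq : ∀ a, x a * x a ≤ Q := fun a =>
      Finset.single_le_sum (f := fun c => x c * x c) (fun c _ => mul_self_nonneg (x c))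
        (Finset.mem_univ a)
    have hprod : ∀ a b, |x a| * |x b| ≤ Q := by
      intro a b
      have h2 := two_mul_le_add_sq (|x a|) (|x b|)
      have ha : |x a| ^ 2 = x a * x a := by rw [sq_abs, sq]
      have hb : |x b| ^ 2 = x b * x b := by rw [sq_abs, sq]
      nlinarith [hsq a, hsq b]
    have hterm : ∀ a b, -(|S a b| * Q) ≤ S a b * (x a * x b) := by
      intro a b
      have habs : |S a b * (x a * x b)| ≤ |S a b| * Q := by
        rw [abs_mul, abs_mul]
        exact mul_le_mul_of_nonneg_left (hprod a b) (abs_nonneg _)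
      exact (abs_le.1 habs).1
    have hexp : star x ⬝ᵥ ((S + Matrix.diagonal (fun _ : Fin m => ∑ a, ∑ b, |S a b|)) *ᵥ x) =
        (∑ a, ∑ b, S a b * (x a * x b)) + (∑ a, ∑ b, |S a b|) * Q := by
      rw [star_trivial, Matrix.add_mulVec, dotProduct_add]
      simp only [dotProduct]
      simp only [Matrix.mulVec_diagonal]
      simp only [Matrix.mulVec, dotProduct, Finset.mul_sum]
      rw [hQ, Finset.mul_sum]
      congr 1
      · refine Finset.sum_congr rfl fun a _ => Finset.sum_congr rfl fun b _ => ?_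
        ring
      · refine Finset.sum_congr rfl fun c _ => ?_
        ring
    rw [hexp]
    have hsum : -((∑ a, ∑ b, |S a b|) * Q) ≤ ∑ a, ∑ b, S a b * (x a * x b) := by
      rw [Finset.sum_mul, ← Finset.sum_neg_distrib]
      refine Finset.sum_le_sum fun a _ => ?_
      rw [Finset.sum_mul, ← Finset.sum_neg_distrib]
      exact Finset.sum_le_sum fun b _ => hterm a b
    linarith

/-! ### The split pencil and its evaluation at `τ^{1/M}` -/

/-- The exponents of the split pencil are pairwise distinct once `M ≥ 2K`:
`(i,b) ↦ M d_i + 2 i + b` is injective on `Fin K × Fin 2 ≃ Fin (K*2)`. [folklore] -/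
theorem splitExp_injective {K : ℕ} (d : Fin K → ℕ) {M : ℕ} (hM : 2 * K ≤ M) :
    Function.Injective fun k : Fin (K * 2) =>
      M * d k.divNat + 2 * (k.divNat : ℕ) + (k.modNat : ℕ) := by
  intro k k' h
  simp only at h
  have hk : (k : ℕ) = 2 * (k.divNat : ℕ) + (k.modNat : ℕ) := by
    rw [Fin.coe_divNat, Fin.coe_modNat]; omega
  have hk' : (k' : ℕ) = 2 * (k'.divNat : ℕ) + (k'.modNat : ℕ) := by
    rw [Fin.coe_divNat, Fin.coe_modNat]; omega
  have hi := (k.divNat).isLt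
  have hi' := (k'.divNat).isLt
  have hb : (k.modNat : ℕ) < 2 := (k.modNat).isLt
  have hb' : (k'.modNat : ℕ) < 2 := (k'.modNat).isLt
  apply Fin.ext
  rcases lt_trichotomy (d k.divNat) (d k'.divNat) with hlt | heq | hgt
  · exfalso
    have hmul : M * d k.divNat + M ≤ M * d k'.divNat := by
      have := Nat.mul_le_mul_left M (Nat.succ_le_of_lt hlt)
      rw [Nat.mul_succ] at this
      exact this
    omega
  · rw [heq] at h
    omega
  · exfalso
    have hmul : M * d k'.divNat + M ≤ M * d k.divNat := by
      have := Nat.mul_le_mul_left M (Nat.succ_le_of_lt hgt)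
      rw [Nat.mul_succ] at this
      exact this
    omega

/-- Reindexing the split pencil along `Fin K × Fin 2 ≃ Fin (K * 2)`: the sum of its `2K` signed
terms is `Σ_i (u^{M d_i + 2i} A_i⁺ − u^{M d_i + 2i + 1} A_i⁻)`. [folklore] -/
theorem sum_split_terms {K m : ℕ} (d : Fin K → ℕ) (M : ℕ) (Ap Am : Fin K → Matrix (Fin m) (Fin m) ℝ)
    (u : ℝ) :
    ∑ k : Fin (K * 2), u ^ (M * d k.divNat + 2 * (k.divNat : ℕ) + (k.modNat : ℕ)) •
        ((if decide ((k.modNat : ℕ) = 0) then (1 : ℝ) else -1) •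
          (if (k.modNat : ℕ) = 0 then Ap k.divNat else Am k.divNat)) =
      ∑ i : Fin K, (u ^ (M * d i + 2 * (i : ℕ)) • Ap i - u ^ (M * d i + (2 * (i : ℕ) + 1)) • Am i) := by
  rw [← Equiv.sum_comp finProdFinEquiv, Fintype.sum_prod_type]
  refine Finset.sum_congr rfl fun i _ => ?_
  have hdiv : ∀ b : Fin 2, (finProdFinEquiv (i, b)).divNat = i := fun b => by
    have h := finProdFinEquiv.symm_apply_apply (i, b)
    rw [finProdFinEquiv_symm_apply] at h
    exact (Prod.mk.inj h).1
  have hmod : ∀ b : Fin 2, ((finProdFinEquiv (i, b)).modNat : ℕ) = b := fun b => by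
    have h := finProdFinEquiv.symm_apply_apply (i, b)
    rw [finProdFinEquiv_symm_apply] at h
    exact congrArg Fin.val (Prod.mk.inj h).2
  rw [Fin.sum_univ_two]
  have h0 : ((0 : Fin 2) : ℕ) = 0 := rfl
  have h1 : ((1 : Fin 2) : ℕ) = 1 := rfl
  simp only [hdiv, hmod, h0, h1, Nat.add_zero]
  simp only [if_true, if_false, one_ne_zero, decide_false, decide_true, Bool.false_eq_true,
    one_smul, neg_smul, smul_neg, sub_eq_add_neg, add_assoc]

/-- `(τ^{1/M})^{M n + c} = τ^n · (τ^{1/M})^c` for `τ ≥ 0`, `M ≠ 0`. [folklore] -/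
theorem rpow_inv_pow {τ : ℝ} (hτ : 0 ≤ τ) {M : ℕ} (hM : M ≠ 0) (n c : ℕ) :
    (τ ^ (1 / (M : ℝ))) ^ (M * n + c) = τ ^ n * (τ ^ (1 / (M : ℝ))) ^ c := by
  rw [pow_add, pow_mul]
  congr 1
  rw [← Real.rpow_natCast (τ ^ (1 / (M : ℝ))) M, ← Real.rpow_mul hτ]
  have hM' : (M : ℝ) ≠ 0 := Nat.cast_ne_zero.2 hM
  rw [one_div_mul_cancel hM', Real.rpow_one]

/-- The matrix family `Φ(t, s) = Σ_i t^{d_i} (s^{2i} A_i⁺ − s^{2i+1} A_i⁻)` (the split pencil evaluated at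
`u = t^{1/M}`, written in the variable `s = t^{1/M}`) is continuous in `s`, and so is its determinant.
[folklore] -/
theorem continuous_det_splitFamily {K m : ℕ} (d : Fin K → ℕ) (Ap Am : Fin K → Matrix (Fin m) (Fin m) ℝ)
    (t : ℝ) :
    Continuous fun s : ℝ =>
      (∑ i : Fin K, ((t ^ d i * s ^ (2 * (i : ℕ))) • Ap i - (t ^ d i * s ^ (2 * (i : ℕ) + 1)) • Am i)).det := by
  refine Continuous.matrix_det ?_
  refine continuous_finsetSum _ fun i _ => ?_
  exact ((continuous_const.mul (continuous_pow _)).smul continuous_const).sub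
    ((continuous_const.mul (continuous_pow _)).smul continuous_const)

/-- At `s = 1` the family `Φ(t, s)` is the original pencil evaluated at `t`, provided `A_i⁺ − A_i⁻ = S_i`.
[folklore] -/
theorem splitFamily_one {K m : ℕ} (d : Fin K → ℕ) (S Ap Am : Fin K → Matrix (Fin m) (Fin m) ℝ)
    (hsplit : ∀ i, Ap i - Am i = S i) (t : ℝ) :
    (∑ i : Fin K, ((t ^ d i * (1 : ℝ) ^ (2 * (i : ℕ))) • Ap i -
        (t ^ d i * (1 : ℝ) ^ (2 * (i : ℕ) + 1)) • Am i)) = ∑ i, t ^ d i • S i := by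
  refine Finset.sum_congr rfl fun i _ => ?_
  rw [one_pow, one_pow, mul_one, ← smul_sub, hsplit]

end Split

open Split

/-- **`stub_split` = the line's `SplitToSemidefinite` (EXPONENT SPLITTING), unfolded.**  `N` strict sign
alternations of the determinant of a symmetric lacunary pencil `Σ_l X^{d_l} S_l` of size `m` with `K`
terms along positive points force `N` distinct positive roots of the determinant of SOME pencil of the
same size `m` with at most `2K` terms, strictly increasing exponents and coefficients `± A_l`,
`A_l ⪰ 0` (split `S = (S + λ·1) − λ·1`, exponents `M d_l + 2l`, `M d_l + 2l + 1`, `u = t^{1/M}`,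
`M → ∞`, IVT via the tree lemma `le_card_posRoots_of_alternating`). [folklore] -/
theorem stub_split :
    ∀ (K m : ℕ) (d : Fin K → ℕ) (S : Fin K → Matrix (Fin m) (Fin m) ℝ), (∀ l, (S l).IsSymm) →
      ∀ (N : ℕ) (τ : Fin (N + 1) → ℝ),
        (StrictMono τ ∧ (∀ j, 0 < τ j) ∧ ∀ j : Fin N,
          (∑ l, (Polynomial.X : ℝ[X]) ^ d l • (S l).map Polynomial.C).det.eval (τ j.castSucc) *
            (∑ l, (Polynomial.X : ℝ[X]) ^ d l • (S l).map Polynomial.C).det.eval (τ j.succ) < 0) →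
        ∃ (K' : ℕ) (d' : Fin K' → ℕ) (σ : Fin K' → Bool) (A : Fin K' → Matrix (Fin m) (Fin m) ℝ),
          K' ≤ 2 * K ∧ StrictMono d' ∧ (∀ l, (A l).PosSemidef) ∧
            N ≤ ((∑ l, (Polynomial.X : ℝ[X]) ^ d' l •
              ((if σ l then (1 : ℝ) else -1) • A l).map Polynomial.C).det.roots.toFinset.filter
                (fun t => 0 < t)).card := by
  intro K m d S hS N τ hAlt
  obtain ⟨hτmono, hτpos, halt⟩ := hAlt
  -- the semidefinite split
  set lam : Fin K → ℝ := fun l => ∑ a, ∑ b, |S l a b| with hlam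
  set Ap : Fin K → Matrix (Fin m) (Fin m) ℝ := fun l => S l + Matrix.diagonal (fun _ => lam l) with hAp
  set Am : Fin K → Matrix (Fin m) (Fin m) ℝ := fun l => Matrix.diagonal (fun _ => lam l) with hAm
  have hlam_nn : ∀ l, 0 ≤ lam l := fun l =>
    Finset.sum_nonneg fun a _ => Finset.sum_nonneg fun b _ => abs_nonneg (S l a b)
  have hAp_psd : ∀ l, (Ap l).PosSemidef := fun l => posSemidef_add_diagonal (S l) (hS l)
  have hAm_psd : ∀ l, (Am l).PosSemidef := fun l => posSemidef_diagonal_const (hlam_nn l)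
  have hsplit : ∀ l, Ap l - Am l = S l := fun l => by simp [hAp, hAm]
  -- the limit `M → ∞`: all sign conditions persist at the points `τ_j^{1/M}`
  set Φ : ℝ → ℝ → ℝ := fun t s =>
    (∑ i : Fin K, ((t ^ d i * s ^ (2 * (i : ℕ))) • Ap i - (t ^ d i * s ^ (2 * (i : ℕ) + 1)) • Am i)).det
    with hΦ
  have hΦone : ∀ t, Φ t 1 =
      ((∑ l, (Polynomial.X : ℝ[X]) ^ d l • (S l).map Polynomial.C).det).eval t := by
    intro t
    rw [eval_det_pencil, ← splitFamily_one d S Ap Am hsplit t]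
  have htend : ∀ t, 0 < t →
      Tendsto (fun M : ℕ => Φ t (t ^ (1 / (M : ℝ)))) atTop (𝓝 (Φ t 1)) := by
    intro t ht
    have h1 : Tendsto (fun M : ℕ => (1 : ℝ) / (M : ℝ)) atTop (𝓝 0) := tendsto_one_div_atTop_nhds_zero_nat
    have h2 : Tendsto (fun x : ℝ => t ^ x) (𝓝 0) (𝓝 (t ^ (0 : ℝ))) :=
      (Real.continuousAt_const_rpow ht.ne').tendsto
    rw [Real.rpow_zero] at h2
    have h3 : Tendsto (fun M : ℕ => t ^ ((1 : ℝ) / (M : ℝ))) atTop (𝓝 1) := h2.comp h1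
    exact ((continuous_det_splitFamily d Ap Am t).tendsto 1).comp h3
  have hev : ∀ᶠ M : ℕ in atTop, ∀ j : Fin N,
      Φ (τ j.castSucc) (τ j.castSucc ^ (1 / (M : ℝ))) * Φ (τ j.succ) (τ j.succ ^ (1 / (M : ℝ))) < 0 := by
    refine eventually_all.2 fun j => ?_
    have hlim := (htend _ (hτpos j.castSucc)).mul (htend _ (hτpos j.succ))
    rw [hΦone, hΦone] at hlim
    exact hlim.eventually (Iio_mem_nhds (halt j))
  obtain ⟨M, hMK, hMalt⟩ := ((eventually_ge_atTop (2 * K + 1)).and hev).exists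
  have hM0 : M ≠ 0 := by omega
  -- the split pencil on `Fin (K * 2)`, sorted by exponent
  set e0 : Fin (K * 2) → ℕ := fun k => M * d k.divNat + 2 * (k.divNat : ℕ) + (k.modNat : ℕ) with he0
  set σ0 : Fin (K * 2) → Bool := fun k => decide ((k.modNat : ℕ) = 0) with hσ0
  set A0 : Fin (K * 2) → Matrix (Fin m) (Fin m) ℝ :=
    fun k => if (k.modNat : ℕ) = 0 then Ap k.divNat else Am k.divNat with hA0
  have he0inj : Function.Injective e0 := splitExp_injective d (by omega)
  set π : Equiv.Perm (Fin (K * 2)) := Tuple.sort e0 with hπ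
  refine ⟨K * 2, e0 ∘ π, σ0 ∘ π, A0 ∘ π, by omega,
    (Tuple.monotone_sort e0).strictMono_of_injective (he0inj.comp π.injective), fun k => ?_, ?_⟩
  · -- positive semidefiniteness
    simp only [Function.comp_apply, hA0]
    split_ifs
    · exact hAp_psd _
    · exact hAm_psd _
  · -- the root count, via the alternation of `det G` at the points `τ_j^{1/M}`
    set G : Matrix (Fin m) (Fin m) ℝ[X] := ∑ l, (Polynomial.X : ℝ[X]) ^ (e0 ∘ π) l •
      ((if (σ0 ∘ π) l then (1 : ℝ) else -1) • (A0 ∘ π) l).map Polynomial.C with hG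
    -- evaluation identity: `det G (t^{1/M}) = Φ t (t^{1/M})` for `t > 0`
    have heval : ∀ t, 0 < t → G.det.eval (t ^ (1 / (M : ℝ))) = Φ t (t ^ (1 / (M : ℝ))) := by
      intro t ht
      rw [hG, eval_det_pencil]
      have hre : (∑ l, (t ^ (1 / (M : ℝ))) ^ (e0 ∘ π) l • ((if (σ0 ∘ π) l then (1 : ℝ) else -1) • (A0 ∘ π) l))
          = ∑ k, (t ^ (1 / (M : ℝ))) ^ e0 k • ((if σ0 k then (1 : ℝ) else -1) • A0 k) :=
        Equiv.sum_comp π (fun k => (t ^ (1 / (M : ℝ))) ^ e0 k • ((if σ0 k then (1 : ℝ) else -1) • A0 k))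
      rw [hre, sum_split_terms d M Ap Am]
      show _ = (∑ i : Fin K, ((t ^ d i * (t ^ (1 / (M : ℝ))) ^ (2 * (i : ℕ))) • Ap i -
        (t ^ d i * (t ^ (1 / (M : ℝ))) ^ (2 * (i : ℕ) + 1)) • Am i)).det
      congr 1
      refine Finset.sum_congr rfl fun i _ => ?_
      rw [rpow_inv_pow ht.le hM0, rpow_inv_pow ht.le hM0]
    refine le_card_posRoots_of_alternating G.det N (fun j => τ j ^ (1 / (M : ℝ))) ?_ ?_ ?_
    · intro i j hij
      exact Real.rpow_lt_rpow (hτpos i).le (hτmono hij) (by positivity)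
    · intro j
      exact Real.rpow_pos_of_pos (hτpos j) _
    · intro j
      show G.det.eval (τ j.castSucc ^ (1 / (M : ℝ))) * G.det.eval (τ j.succ ^ (1 / (M : ℝ))) < 0
      rw [heval _ (hτpos _), heval _ (hτpos _)]
      exact hMalt j

end Summit.ValiantsHypothesis.ValiantsHypothesis.Theorems.LacunarySymmetroidMatrixDescartes
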